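import Literature.AlgebraicGeometry.HodgeTheory.WeilTypeAbelianVariety
import Literature.AlgebraicGeometry.HodgeTheory.JacobianHodgeGenus
import Literature.AlgebraicGeometry.HodgeTheory.HodgeClassesIsogenyInvariance
import HarnessLib

/-!
# Quaternion multiplication forces Weil type (van Geemen–Verra 2003, Lemma 4.5) on the real carriers

Layer `Literature/AlgebraicGeometry/HodgeTheory`, companion of `WeilTypeAbelianVariety` (van Geemen's
Definition 4.9 `IsWeilType A φ n d` on the carriers `H¹(A(ℂ); ℂ) ⊇ H^{1,0}`). THEOREMS ONLY: no
definition, no named fact, no `sorry`; every statement is proved from the tree's carrier algebra of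
`H¹` (`AbelianVarietyEndomorphismsHOne`: additivity of `f ↦ f^*` on `H¹`, `(φ^*)² = -d`, the eigenspaces
`V_± = ker(φ^* ∓ i√d)`; `DegreeOneHodgeTypes`: `H^{1,0}`, `g^* H^{1,0} ⊆ H^{1,0}`; `JacobianHodgeGenus`:
`h^{1,0}(A) = dim A`).

HONEST FRAMING (cell `pub-hodge-ring2`, verbatim): research route conditional on HC_CM; not a corollary;
Q11.4-sentence-2 already refuted in dim ≥ 3. This file uses neither `HC_CM` nor any conjectural
statement; it is the kernel form of ONE printed lemma.

## The printed statement and its proof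

van Geemen–Verra, *Quaternionic Pryms and Hodge classes*, Topology 42 (2003), **Lemma 4.5**
(verbatim, held text `paper:arxiv-math_0103111` p. 9): "Let `(A, E, F)` be an abelian variety of
quaternion type. Let `K ⊂ F` be a quadratic extension of `ℚ`. Then `A` is of Weil type for `K`." Proof
(verbatim): "Since `F` is definite, `K ⊂ F` must be an imaginary quadratic field. Moreover, there is a
`j ∈ F` such that `F = K ⊕ Kj` and `xj = j x̄` for `x ∈ K`. Hence the eigenspaces of `x` are permuted
by the action of `j` on `T₀A` and therefore they have the same dimension." ("A more general statement
is proved in [A], §4" = Abdulali, IJM 10 (1999).) The same multiplicity statement for the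
non-commutative Albert types is Moonen–Zarhin's `m_σ = m_σ̄` (Math. Ann. 315 (1999), §2, the `g = 4`
list: types II, III carry a Weil plane of type `(2,2)`).

RENDERING. `K = ℚ(φ)` with `φ ≫ φ = -(d • 𝟙 A)`, `d ≥ 1` (the tree's convention, `√-d ↦ φ`); the
element `j` is an endomorphism `ψ` which ANTICOMMUTES with `φ`, `φ ≫ ψ = -(ψ ≫ φ)` (this is
`xj = j x̄` for `x = φ`, `x̄ = -φ`), and which is injective on `H¹(A(ℂ); ℂ)` — automatic when
`ψ ≫ ψ = -(e • 𝟙 A)`, `e ≥ 1` (so `F ⊇ (-d, -e)_ℚ`, the DEFINITE case of the lemma), when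
`ψ ≫ ψ = e • 𝟙 A`, `e ≥ 1` (an indefinite quaternion algebra `(-d, e)_ℚ`, Albert type II — the lemma's
proof uses only `xj = j x̄` and the invertibility of `j`), or when `ψ` is an isogeny. The tangent space
`T₀A = (H^{1,0})^∨` is replaced by `H^{1,0} ⊆ H¹(A(ℂ); ℂ)` (same multiplicities).

PROOF ON THE CARRIERS (the printed one): `ψ^*` anticommutes with `φ^*` on `H¹`
(`complexBetti_map_map_one_of_anticomm`, from functoriality and `(-f)^* = -f^*`), hence maps the
`i√d`-eigenspace `V₊` into `V₋` and `V₋` into `V₊` (`map_mem_eigenspace_neg_of_anticomm`); it preserves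
`H^{1,0}` (`map_mem_hodgeOneZero`) and is injective, so `dim (V₊ ∩ H^{1,0}) ≤ dim (V₋ ∩ H^{1,0})` and
conversely (`finrank_eigenspace_inf_hodgeOneZero_le_of_anticomm`); and
`H^{1,0} = (V₊ ∩ H^{1,0}) ⊕ (V₋ ∩ H^{1,0})` because `φ^*` preserves `H^{1,0}` with `(φ^*)² = -d`
(`hodgeOneZero_le_sup_eigenspace_inf`, `finrank_eigenspace_inf_hodgeOneZero_add_neg`), so both
multiplicities equal `½ h^{1,0} = ½ dim A = n`.

## Main statements

* `isWeilType_of_anticomm_of_injective` — `dim A = 2n`, `φ² = -d`, `φψ = -ψφ`, `ψ^*` injective on `H¹`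
  ⟹ `IsWeilType A φ n d`; specialisations `isWeilType_of_anticomm` (`ψ² = -e`: definite
  `(-d,-e)_ℚ`, Lemma 4.5 as printed), `isWeilType_of_anticomm_of_sq_eq_nsmul` (`ψ² = +e`),
  `isWeilType_of_anticomm_of_isIsogeny`; and `isWeilType_of_anticomm'` (Weil type for `ℚ(ψ)` too).
* `weilClasses_isOfHodgeType_of_anticomm` — the Weil plane `weilClassesOf A φ n d` is of Hodge type
  `(n, n)` (van Geemen 4.10 ⟸ 4.9, the tree's `IsWeilType.isOfHodgeType_of_mem_weilClassesOf`): the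
  literal Weil-plane binder of the ring-2 atlas cells (`… → (∀ c ∈ weilClassesOf A φ 2 d,
  IsOfHodgeType 4 A.X 4 2 2 c) → …`) for every abelian fourfold with quaternion multiplication.
* `comp_ne_comp_of_anticomm` — `φ ≫ ψ ≠ ψ ≫ φ` (the non-commutativity binder of the same cells):
  an anticommuting pair of `H¹`-injective endomorphisms of a positive-dimensional abelian variety never
  commutes (`2·(ψφ)^* = 0` on `H¹ ≠ 0` is absurd).
* `isWeilType_comp_of_anticomm`, `isWeilType_pure_of_anticomm` (§ "Every quadratic subfield") — the
  lemma's universal quantifier "for every quadratic `K ⊂ F`": the third generator `φψ` (`(φψ)² = -de`)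
  and every integral pure element `x = a·φ + b·ψ + c·φψ ≠ 0` (`x² = -(a²d + b²e + c²de)`, computed in
  the preadditive `End(A)`) give Weil-type structures `IsWeilType A x n (a²d + b²e + c²de)`, the
  anticommuting partner being `be·φ - ad·ψ` (resp. `φ` when `x = c·φψ`).

NOT here (and not claimed): simplicity of `A`; the DISCRIMINANT of the Weil structure `(A, ℚ(φ))`
(Lemma R1 of the cell's seat ab-weil-2 — it needs `H₁(A, ℚ)` with its Riemann form, absent from the
carriers); `W_F` and its independence of `K` (van Geemen–Verra 4.6–4.7, representation theory of
`GL₂`); Abdulali's orbit corollary 4.9.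

## References

* [vanGeemenVerra2003QuaternionicPryms] B. van Geemen, A. Verra, Quaternionic Pryms and Hodge classes,
  Topology 42 (2003) 35–53, Lemma 4.5 and its proof (held: `paper:arxiv-math_0103111`, p. 9).
* [vanGeemen1994HodgeAV] B. van Geemen, An introduction to the Hodge conjecture for abelian varieties,
  LNM 1594 (1994), 4.9–4.10, 4.13, Lemma 5.2.
* [MoonenZarhin1999LowDim] B. Moonen, Yu. Zarhin, Hodge classes on abelian varieties of low dimension,
  Math. Ann. 315 (1999) 711–733, §2 (multiplicities `m_σ = m_σ̄` for the non-commutative types).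
* [LangeBirkenhake1992] H. Lange, Ch. Birkenhake, Complex abelian varieties (1992), §1.1 (the
  representation `End(X) → End(H¹)` is a ring homomorphism).
-/

noncomputable section

open CategoryTheory
open Literature.AlgebraicTopology.SingularHomology
open Literature.AlgebraicGeometry.Motives (IsSmoothProjective AbelianVariety)

namespace Literature.AlgebraicGeometry.HodgeTheory

section QuaternionAction

variable {A : Motives.AbelianVariety ℂ} {φ ψ : A ⟶ A} {m n d e : ℕ}

/-! ### `ψ^*` anticommutes with `φ^*` on `H¹` and swaps the eigenspaces `V_±` -/

/-- **Anticommuting endomorphisms anticommute on `H¹`**: `φ ≫ ψ = -(ψ ≫ φ)` gives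
`φ^*(ψ^* c) = -ψ^*(φ^* c)` on `H¹(A(ℂ); ℂ)` (functoriality `f^* g^* = (f ≫ g)^*` and additivity
`(-f)^* = -f^*` of the representation on `H¹`; van Geemen–Verra: "`xj = j x̄`").
[cite: vanGeemenVerra2003QuaternionicPryms, proof of Lemma 4.5] [cite: LangeBirkenhake1992, §1.1 (p. 19)] -/
theorem complexBetti_map_map_one_of_anticomm (h : φ ≫ ψ = -(ψ ≫ φ)) (c : complexBetti A.X 1) :
    complexBetti.map φ.hom.hom.hom 1 (complexBetti.map ψ.hom.hom.hom 1 c) =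
      -(complexBetti.map ψ.hom.hom.hom 1 (complexBetti.map φ.hom.hom.hom 1 c)) := by
  rw [complexBetti_map_map_hom φ ψ c, complexBetti_map_map_hom ψ φ c, h, complexBetti_map_neg_one]
  change ((-(complexBetti.map (ψ ≫ φ).hom.hom.hom 1)).hom) c = _
  rw [ModuleCat.hom_neg, LinearMap.neg_apply]

/-- **`ψ^*` maps the `μ`-eigenspace of `φ^*` into the `(-μ)`-eigenspace** when `φψ = -ψφ` ("the
eigenspaces of `x` are permuted by the action of `j`").
[cite: vanGeemenVerra2003QuaternionicPryms, proof of Lemma 4.5] -/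
theorem map_mem_eigenspace_neg_of_anticomm (h : φ ≫ ψ = -(ψ ≫ φ)) {μ : ℂ} {v : complexBetti A.X 1}
    (hv : v ∈ Module.End.eigenspace (complexBetti.map φ.hom.hom.hom 1).hom μ) :
    (complexBetti.map ψ.hom.hom.hom 1).hom v ∈
      Module.End.eigenspace (complexBetti.map φ.hom.hom.hom 1).hom (-μ) := by
  rw [Module.End.mem_eigenspace_iff] at hv ⊢
  change complexBetti.map φ.hom.hom.hom 1 (complexBetti.map ψ.hom.hom.hom 1 v) =
    -μ • complexBetti.map ψ.hom.hom.hom 1 v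
  have hv' : complexBetti.map φ.hom.hom.hom 1 v = μ • v := hv
  rw [complexBetti_map_map_one_of_anticomm h, hv', map_smul, neg_smul]

/-- **`ψ ≫ ψ = -(e • 𝟙 A)` with `e ≥ 1` makes `ψ^*` injective on `H¹`** (`(ψ^*)² = -e` is invertible).
[cite: vanGeemen1994HodgeAV, Lemma 5.2] -/
theorem complexBetti_map_one_injective_of_comp_self (hψ : ψ ≫ ψ = -(e • 𝟙 A)) (he : 0 < e) :
    Function.Injective (complexBetti.map ψ.hom.hom.hom 1) := by
  intro v w hvw
  have h := congrArg (complexBetti.map ψ.hom.hom.hom 1) hvw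
  rw [complexBetti_map_map_one_of_comp_self hψ, complexBetti_map_map_one_of_comp_self hψ, neg_inj] at h
  exact smul_right_injective _ (Nat.cast_ne_zero.2 he.ne') h

/-- `ψ ≫ ψ = e • 𝟙 A` with `e ≥ 1` (e.g. `j² = e > 0` in an indefinite quaternion algebra `(-d, e)_ℚ`)
also makes `ψ^*` injective on `H¹` (`(ψ^*)² = e`). [cite: MumfordAV1970, §19 Remark p. 169] -/
theorem complexBetti_map_one_injective_of_comp_self_eq_nsmul (hψ : ψ ≫ ψ = e • 𝟙 A) (he : 0 < e) :
    Function.Injective (complexBetti.map ψ.hom.hom.hom 1) :=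
  complexBetti_map_injective_of_comp_eq_nsmul_id he.ne' hψ 1

/-! ### The two multiplicities are equal, and they add up to `dim A` -/

/-- **`dim (V_μ ∩ H^{1,0}) ≤ dim (V_{-μ} ∩ H^{1,0})`** for an `H¹`-injective `ψ` anticommuting with
`φ`: `ψ^*` restricts to an injective linear map `V_μ ∩ H^{1,0} → V_{-μ} ∩ H^{1,0}` (it swaps the
eigenspaces and preserves Hodge types). [cite: vanGeemenVerra2003QuaternionicPryms, proof of Lemma 4.5] -/
theorem finrank_eigenspace_inf_hodgeOneZero_le_of_anticomm (hX : IsSmoothProjective m A.X)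
    (h : φ ≫ ψ = -(ψ ≫ φ)) (hS : Function.Injective (complexBetti.map ψ.hom.hom.hom 1)) (μ : ℂ) :
    Module.finrank ℂ ↥(Module.End.eigenspace (complexBetti.map φ.hom.hom.hom 1).hom μ ⊓ hodgeOneZero hX) ≤
      Module.finrank ℂ
        ↥(Module.End.eigenspace (complexBetti.map φ.hom.hom.hom 1).hom (-μ) ⊓ hodgeOneZero hX) := by
  haveI := finite_complexBetti_abelianVariety A 1
  let f : ↥(Module.End.eigenspace (complexBetti.map φ.hom.hom.hom 1).hom μ ⊓ hodgeOneZero hX) →ₗ[ℂ]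
      ↥(Module.End.eigenspace (complexBetti.map φ.hom.hom.hom 1).hom (-μ) ⊓ hodgeOneZero hX) :=
    LinearMap.codRestrict _ ((complexBetti.map ψ.hom.hom.hom 1).hom.domRestrict _)
      (fun v ↦ ⟨map_mem_eigenspace_neg_of_anticomm h v.2.1, map_mem_hodgeOneZero hX ψ.hom.hom.hom v.2.2⟩)
  refine LinearMap.finrank_le_finrank_of_injective (f := f) fun v w hvw ↦ ?_
  apply Subtype.ext
  exact hS (congrArg Subtype.val hvw)

/-- **`H^{1,0} ⊆ (V₊ ∩ H^{1,0}) + (V₋ ∩ H^{1,0})`**: `φ^*` preserves `H^{1,0}` and satisfies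
`(φ^*)² = -d` there, so every `(1,0)`-class splits as `v = v₊ + v₋`,
`v_± = (2i√d)⁻¹ (i√d·v ± φ^* v) ∈ V_± ∩ H^{1,0}` (van Geemen 5.2: "`H^{1,0} = V₊^{1,0} ⊕ V₋^{1,0}`").
[cite: vanGeemen1994HodgeAV, proof of Lemma 5.2 (1)] -/
theorem hodgeOneZero_le_sup_eigenspace_inf (hX : IsSmoothProjective m A.X) (hd : 0 < d)
    (hφ : φ ≫ φ = -(d • 𝟙 A)) :
    hodgeOneZero hX ≤
      Module.End.eigenspace (complexBetti.map φ.hom.hom.hom 1).hom (Complex.I * (Real.sqrt d : ℂ)) ⊓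
          hodgeOneZero hX ⊔
        Module.End.eigenspace (complexBetti.map φ.hom.hom.hom 1).hom (-(Complex.I * (Real.sqrt d : ℂ))) ⊓
          hodgeOneZero hX := by
  intro v hv
  obtain ⟨μ, hμdef⟩ : ∃ μ : ℂ, Complex.I * (Real.sqrt d : ℂ) = μ := ⟨_, rfl⟩
  have hμ : μ ≠ 0 := by rw [← hμdef]; exact I_mul_sqrt_ne_zero hd
  have hμ2 : μ * μ = -(d : ℂ) := by rw [← hμdef, ← sq, I_mul_sqrt_sq]
  rw [hμdef]
  set T := (complexBetti.map φ.hom.hom.hom 1).hom with hT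
  have hT2 : T (T v) = -((d : ℂ) • v) := complexBetti_map_map_one_of_comp_self hφ v
  have hTv : T v ∈ hodgeOneZero hX := map_mem_hodgeOneZero hX φ.hom.hom.hom hv
  have h2μ : (2 * μ) ≠ 0 := mul_ne_zero two_ne_zero hμ
  -- the two components
  have hplus : (2 * μ)⁻¹ • (μ • v + T v) ∈
      Module.End.eigenspace T μ ⊓ hodgeOneZero hX := by
    refine ⟨Module.End.mem_eigenspace_iff.2 ?_, Submodule.smul_mem _ _ (Submodule.add_mem _
      (Submodule.smul_mem _ _ hv) hTv)⟩
    rw [map_smul, map_add, map_smul, hT2]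
    match_scalars <;> first | ring1 | linear_combination (-(2 * μ)⁻¹) * hμ2
  have hminus : (2 * μ)⁻¹ • (μ • v - T v) ∈
      Module.End.eigenspace T (-μ) ⊓ hodgeOneZero hX := by
    refine ⟨Module.End.mem_eigenspace_iff.2 ?_, Submodule.smul_mem _ _ (Submodule.sub_mem _
      (Submodule.smul_mem _ _ hv) hTv)⟩
    rw [map_smul, map_sub, map_smul, hT2]
    match_scalars <;> first | ring1 | linear_combination (2 * μ)⁻¹ * hμ2
  have hsum : v = (2 * μ)⁻¹ • (μ • v + T v) + (2 * μ)⁻¹ • (μ • v - T v) := by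
    match_scalars <;> field_simp <;> ring
  rw [hsum]
  exact Submodule.add_mem_sup hplus hminus

/-- **`dim (V₊ ∩ H^{1,0}) + dim (V₋ ∩ H^{1,0}) = dim A`** (`= h^{1,0}(A)`): the two pieces span
`H^{1,0}` (`hodgeOneZero_le_sup_eigenspace_inf`) and meet in `V₊ ∩ V₋ = 0`. Van Geemen 4.9 / 5.2:
the `K`-multiplicities on `T₀X` add up to `dim X`. [cite: vanGeemen1994HodgeAV, 4.9 and proof of Lemma 5.2 (1)] -/
theorem finrank_eigenspace_inf_hodgeOneZero_add_neg (hX : IsSmoothProjective m A.X) (hd : 0 < d)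
    (hφ : φ ≫ φ = -(d • 𝟙 A)) :
    Module.finrank ℂ ↥(Module.End.eigenspace (complexBetti.map φ.hom.hom.hom 1).hom
          (Complex.I * (Real.sqrt d : ℂ)) ⊓ hodgeOneZero hX) +
      Module.finrank ℂ ↥(Module.End.eigenspace (complexBetti.map φ.hom.hom.hom 1).hom
          (-(Complex.I * (Real.sqrt d : ℂ))) ⊓ hodgeOneZero hX) = A.dim := by
  haveI := finite_complexBetti_abelianVariety A 1
  have hsup : Module.End.eigenspace (complexBetti.map φ.hom.hom.hom 1).hom
          (Complex.I * (Real.sqrt d : ℂ)) ⊓ hodgeOneZero hX ⊔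
        Module.End.eigenspace (complexBetti.map φ.hom.hom.hom 1).hom
          (-(Complex.I * (Real.sqrt d : ℂ))) ⊓ hodgeOneZero hX = hodgeOneZero hX :=
    le_antisymm (sup_le inf_le_right inf_le_right) (hodgeOneZero_le_sup_eigenspace_inf hX hd hφ)
  have hinf : Module.End.eigenspace (complexBetti.map φ.hom.hom.hom 1).hom
          (Complex.I * (Real.sqrt d : ℂ)) ⊓ hodgeOneZero hX ⊓
        (Module.End.eigenspace (complexBetti.map φ.hom.hom.hom 1).hom
          (-(Complex.I * (Real.sqrt d : ℂ))) ⊓ hodgeOneZero hX) = ⊥ :=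
    eq_bot_iff.2 ((inf_le_inf inf_le_left inf_le_left).trans
      (eigenspace_inf_eigenspace_neg_eq_bot hd φ).le)
  have h := Submodule.finrank_sup_add_finrank_inf_eq
    (Module.End.eigenspace (complexBetti.map φ.hom.hom.hom 1).hom
      (Complex.I * (Real.sqrt d : ℂ)) ⊓ hodgeOneZero hX)
    (Module.End.eigenspace (complexBetti.map φ.hom.hom.hom 1).hom
      (-(Complex.I * (Real.sqrt d : ℂ))) ⊓ hodgeOneZero hX)
  rw [hsup, hinf, finrank_bot, add_zero, AbelianVariety.finrank_hodgeOneZero_eq_dim A hX] at h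
  exact h.symm

/-! ### Van Geemen–Verra's Lemma 4.5 -/

/-- **Quaternion multiplication forces Weil type** (van Geemen–Verra 2003, Lemma 4.5, carrier form):
a complex abelian `2n`-fold `A` (`n ≥ 1`) with endomorphisms `φ`, `ψ` such that `φ ≫ φ = -(d • 𝟙 A)`
(`d ≥ 1`, `K = ℚ(φ) ≅ ℚ(√-d)`), `φ ≫ ψ = -(ψ ≫ φ)` (`xj = j x̄`) and `ψ^*` injective on `H¹(A(ℂ); ℂ)`
is of Weil type `(n, d)` for `K`: the eigenvalue `i√d` of `φ^*` has multiplicity `n` on `H^{1,0}`.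
[cite: vanGeemenVerra2003QuaternionicPryms, Lemma 4.5] [cite: MoonenZarhin1999LowDim, §2] -/
theorem isWeilType_of_anticomm_of_injective (hn : 0 < n) (hd : 0 < d) (hA : A.dim = 2 * n)
    (hφ : φ ≫ φ = -(d • 𝟙 A)) (h : φ ≫ ψ = -(ψ ≫ φ))
    (hS : Function.Injective (complexBetti.map ψ.hom.hom.hom 1)) : IsWeilType A φ n d := by
  have hle := finrank_eigenspace_inf_hodgeOneZero_le_of_anticomm
    (Motives.isSmoothProjective_of_dim_eq' hA) h hS (Complex.I * (Real.sqrt d : ℂ))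
  have hge := finrank_eigenspace_inf_hodgeOneZero_le_of_anticomm
    (Motives.isSmoothProjective_of_dim_eq' hA) h hS (-(Complex.I * (Real.sqrt d : ℂ)))
  rw [neg_neg] at hge
  have hsum := finrank_eigenspace_inf_hodgeOneZero_add_neg (Motives.isSmoothProjective_of_dim_eq' hA) hd hφ
  rw [hA] at hsum
  exact ⟨hn, hd, hA, hφ, by omega⟩

/-- **Lemma 4.5 as printed (definite quaternion algebra)**: `φ² = -d`, `ψ² = -e` (`d, e ≥ 1`),
`φψ = -ψφ` — i.e. `(-d, -e)_ℚ ↪ End⁰(A)` with integral standard generators — on a `2n`-fold `A`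
⟹ `(A, ℚ(φ))` is of Weil type `(n, d)`. [cite: vanGeemenVerra2003QuaternionicPryms, Lemma 4.5] -/
theorem isWeilType_of_anticomm (hn : 0 < n) (hd : 0 < d) (he : 0 < e) (hA : A.dim = 2 * n)
    (hφ : φ ≫ φ = -(d • 𝟙 A)) (hψ : ψ ≫ ψ = -(e • 𝟙 A)) (h : φ ≫ ψ = -(ψ ≫ φ)) :
    IsWeilType A φ n d :=
  isWeilType_of_anticomm_of_injective hn hd hA hφ h (complexBetti_map_one_injective_of_comp_self hψ he)

/-- … and symmetrically `(A, ℚ(ψ))` is of Weil type `(n, e)` (every quadratic subfield of `F`).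
[cite: vanGeemenVerra2003QuaternionicPryms, Lemma 4.5] -/
theorem isWeilType_of_anticomm' (hn : 0 < n) (hd : 0 < d) (he : 0 < e) (hA : A.dim = 2 * n)
    (hφ : φ ≫ φ = -(d • 𝟙 A)) (hψ : ψ ≫ ψ = -(e • 𝟙 A)) (h : φ ≫ ψ = -(ψ ≫ φ)) :
    IsWeilType A ψ n e :=
  isWeilType_of_anticomm hn he hd hA hψ hφ (by rw [h, neg_neg])

/-- The indefinite variant (`ψ² = +e`, `e ≥ 1`, an indefinite quaternion algebra `(-d, e)_ℚ`, Albert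
type II): still of Weil type for `ℚ(φ)` (the proof of Lemma 4.5 uses only `xj = j x̄` and `j`
invertible; Moonen–Zarhin: `m_σ = m_σ̄` for type II). [cite: vanGeemenVerra2003QuaternionicPryms, proof of Lemma 4.5]
[cite: MoonenZarhin1999LowDim, §2] -/
theorem isWeilType_of_anticomm_of_sq_eq_nsmul (hn : 0 < n) (hd : 0 < d) (he : 0 < e)
    (hA : A.dim = 2 * n) (hφ : φ ≫ φ = -(d • 𝟙 A)) (hψ : ψ ≫ ψ = e • 𝟙 A) (h : φ ≫ ψ = -(ψ ≫ φ)) :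
    IsWeilType A φ n d :=
  isWeilType_of_anticomm_of_injective hn hd hA hφ h
    (complexBetti_map_one_injective_of_comp_self_eq_nsmul hψ he)

/-- The isogeny variant: an ISOGENY `ψ` anticommuting with `φ` forces Weil type for `ℚ(φ)` (`ψ^*` is
bijective on `H¹`, `complexBetti_map_bijective_of_isIsogeny`).
[cite: vanGeemenVerra2003QuaternionicPryms, proof of Lemma 4.5] -/
theorem isWeilType_of_anticomm_of_isIsogeny (hn : 0 < n) (hd : 0 < d) (hA : A.dim = 2 * n)
    (hφ : φ ≫ φ = -(d • 𝟙 A)) (hψ : AbelianVariety.IsIsogeny ψ) (h : φ ≫ ψ = -(ψ ≫ φ)) :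
    IsWeilType A φ n d :=
  isWeilType_of_anticomm_of_injective hn hd hA hφ h (complexBetti_map_bijective_of_isIsogeny hψ 1).1

/-- **The Weil plane of `(A, ℚ(φ))` is of Hodge type `(n, n)`** under quaternion multiplication
(Lemma 4.5 followed by van Geemen 4.10 / Deligne–Milne Prop. 4.4 ⟸, the tree's
`IsWeilType.isOfHodgeType_of_mem_weilClassesOf`) — the literal Weil-plane binder of the ring-2 atlas
cells. [cite: vanGeemenVerra2003QuaternionicPryms, Lemma 4.5] [cite: vanGeemen1994HodgeAV, 4.10] -/
theorem weilClasses_isOfHodgeType_of_anticomm (hn : 0 < n) (hd : 0 < d) (he : 0 < e)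
    (hA : A.dim = 2 * n) (hφ : φ ≫ φ = -(d • 𝟙 A)) (hψ : ψ ≫ ψ = -(e • 𝟙 A))
    (h : φ ≫ ψ = -(ψ ≫ φ)) :
    ∀ c ∈ weilClassesOf A φ n d, IsOfHodgeType (2 * n) A.X (2 * n) n n c :=
  fun _ hc ↦ (isWeilType_of_anticomm hn hd he hA hφ hψ h).isOfHodgeType_of_mem_weilClassesOf hc

/-! ### Anticommuting endomorphisms do not commute -/

/-- **`φ ≫ ψ ≠ ψ ≫ φ`**: two `H¹`-injective endomorphisms of a positive-dimensional complex abelian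
variety which anticommute do not commute — otherwise `(ψ ≫ φ)^* = -(ψ ≫ φ)^*`, so `2·(ψφ)^* = 0` on
`H¹(A(ℂ); ℂ) ≠ 0`, contradicting injectivity (the non-commutativity of a quaternion algebra
`F ⊂ End⁰(A)`: `ij = -ji` with `i, j` invertible, van Geemen–Verra §1.1; recorded as the binder
`∃ ψ χ, ψ ≫ χ ≠ χ ≫ ψ` of the ring-2 atlas cells; the argument is the injectivity of the rational
representation `ρ_r : End(X) → End_ℤ(H₁(X, ℤ))`, Lange–Birkenhake §1.2, read on `H¹(A(ℂ); ℂ)`).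
[cite: vanGeemenVerra2003QuaternionicPryms, §1.1] [cite: LangeBirkenhake1992, §1.2 (ρ_r injective, p. 10)] -/
theorem comp_ne_comp_of_anticomm (hA : 0 < A.dim) (h : φ ≫ ψ = -(ψ ≫ φ))
    (hT : Function.Injective (complexBetti.map φ.hom.hom.hom 1))
    (hS : Function.Injective (complexBetti.map ψ.hom.hom.hom 1)) : φ ≫ ψ ≠ ψ ≫ φ := by
  intro hc
  haveI := finite_complexBetti_abelianVariety A 1
  -- a non-zero class in `H¹`
  have hpos : 0 < Module.finrank ℂ (complexBetti A.X 1) := by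
    rw [Motives.AbelianVariety.finrank_complexBetti_one]; omega
  obtain ⟨v, hv⟩ := Module.finrank_pos_iff_exists_ne_zero.1 hpos
  -- `(ψ ≫ φ)^* v = -(ψ ≫ φ)^* v`
  have h1 : complexBetti.map (ψ ≫ φ).hom.hom.hom 1 v = -(complexBetti.map (ψ ≫ φ).hom.hom.hom 1 v) := by
    conv_lhs => rw [← hc, h, complexBetti_map_neg_one]
    change ((-(complexBetti.map (ψ ≫ φ).hom.hom.hom 1)).hom) v = _
    rw [ModuleCat.hom_neg, LinearMap.neg_apply]
  have h2 : (2 : ℂ) • complexBetti.map (ψ ≫ φ).hom.hom.hom 1 v = 0 := by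
    rw [two_smul]; exact eq_neg_iff_add_eq_zero.1 h1
  have h3 : complexBetti.map (ψ ≫ φ).hom.hom.hom 1 v = 0 :=
    (smul_eq_zero.1 h2).resolve_left two_ne_zero
  rw [← complexBetti_map_map_hom ψ φ v] at h3
  have h4 : complexBetti.map φ.hom.hom.hom 1 v = 0 := hS (by rw [h3, map_zero])
  exact hv (hT (by rw [h4, map_zero]))

/-- The definite-quaternion instance of `comp_ne_comp_of_anticomm`: `φ² = -d`, `ψ² = -e`, `d, e ≥ 1`,
`φψ = -ψφ` on a positive-dimensional `A` ⟹ `φ ≫ ψ ≠ ψ ≫ φ` (a definite quaternion algebra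
`(-d, -e)_ℚ ↪ End⁰(A)` is non-commutative). [cite: vanGeemenVerra2003QuaternionicPryms, §1.1]
[cite: LangeBirkenhake1992, §1.2 (ρ_r injective, p. 10)] -/
theorem comp_ne_comp_of_anticomm_of_comp_self (hA : 0 < A.dim) (hd : 0 < d) (he : 0 < e)
    (hφ : φ ≫ φ = -(d • 𝟙 A)) (hψ : ψ ≫ ψ = -(e • 𝟙 A)) (h : φ ≫ ψ = -(ψ ≫ φ)) :
    φ ≫ ψ ≠ ψ ≫ φ :=
  comp_ne_comp_of_anticomm hA h (complexBetti_map_one_injective_of_comp_self hφ hd)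
    (complexBetti_map_one_injective_of_comp_self hψ he)

/-- **Fourfolds with definite quaternion multiplication meet the Weil-plane and non-commutativity
binders of the ring-2 type III cell**: `dim A = 4`, `φ² = -d`, `ψ² = -e`, `φψ = -ψφ` ⟹ every class of
`weilClassesOf A φ 2 d` is of Hodge type `(2,2)` AND `∃ ψ χ, ψ ≫ χ ≠ χ ≫ ψ` (Moonen–Zarhin's `g = 4`
list: the non-commutative types carry a `(2,2)` Weil plane). Simplicity is NOT concluded.
[cite: vanGeemenVerra2003QuaternionicPryms, Lemma 4.5] [cite: MoonenZarhin1999LowDim, §2] -/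
theorem weilClasses_isOfHodgeType_and_noncomm_of_fourfold (hd : 0 < d) (he : 0 < e) (hA : A.dim = 4)
    (hφ : φ ≫ φ = -(d • 𝟙 A)) (hψ : ψ ≫ ψ = -(e • 𝟙 A)) (h : φ ≫ ψ = -(ψ ≫ φ)) :
    (∀ c ∈ weilClassesOf A φ 2 d, IsOfHodgeType 4 A.X 4 2 2 c) ∧ ∃ ψ χ : A ⟶ A, ψ ≫ χ ≠ χ ≫ ψ :=
  ⟨weilClasses_isOfHodgeType_of_anticomm two_pos hd he hA hφ hψ h,
    ⟨φ, ψ, comp_ne_comp_of_anticomm_of_comp_self (by omega) hd he hφ hψ h⟩⟩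

end QuaternionAction

/-! ### Every quadratic subfield of `F = (-d, -e)_ℚ`: the pure elements `aφ + bψ + cφψ`

Van Geemen–Verra's Lemma 4.5 is stated for EVERY quadratic subfield `K ⊂ F`; the quadratic subfields of
`F = (-d, -e)_ℚ = ℚ⟨i, j⟩` are the `ℚ(x)` for pure quaternions `x = a i + b j + c ij ≠ 0`
(`x² = -(a²d + b²e + c²de) < 0`), and every pure `x` has a pure `y ≠ 0` with `xy = -yx` (any `y`
orthogonal to `x` for the norm form; explicitly `y = be·i - ad·j` when `(a, b) ≠ (0, 0)`, `y = i` when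
`x = c·ij`). The endomorphism ring `End(A)` is Mathlib's preadditive `End`, so the integral pure elements
`a • φ + b • ψ + c • (φ ≫ ψ)` (`a b c : ℤ`) make sense as endomorphisms and the lemma applies to them. -/

section EverySubfield

variable {A : Motives.AbelianVariety ℂ} {φ ψ : A ⟶ A} {n d e : ℕ}

/-- `ψφ = -φψ` (the anticommutation read from the other side). [cite: vanGeemenVerra2003QuaternionicPryms, §1.1] -/
theorem comp_eq_neg_comp_of_anticomm (h : φ ≫ ψ = -(ψ ≫ φ)) : ψ ≫ φ = -(φ ≫ ψ) := by
  rw [h, neg_neg]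

/-- `i(ij) = -d·j`: `φ ≫ (φ ≫ ψ) = -(d • ψ)`. [cite: vanGeemenVerra2003QuaternionicPryms, §1.1] -/
theorem comp_comp_right_of_sq (hφ : φ ≫ φ = -(d • 𝟙 A)) : φ ≫ (φ ≫ ψ) = -((d : ℤ) • ψ) := by
  rw [← Category.assoc, hφ, Preadditive.neg_comp, Preadditive.nsmul_comp, Category.id_comp, natCast_zsmul]

/-- `j(ij) = e·i`: `ψ ≫ (φ ≫ ψ) = e • φ` (from `ji = -ij`, `j² = -e`). [cite: vanGeemenVerra2003QuaternionicPryms, §1.1] -/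
theorem comp_comp_right_of_sq' (hψ : ψ ≫ ψ = -(e • 𝟙 A)) (h : φ ≫ ψ = -(ψ ≫ φ)) :
    ψ ≫ (φ ≫ ψ) = (e : ℤ) • φ := by
  rw [← Category.assoc, comp_eq_neg_comp_of_anticomm h, Preadditive.neg_comp, Category.assoc, hψ,
    Preadditive.comp_neg, Preadditive.comp_nsmul, Category.comp_id, neg_neg, natCast_zsmul]

/-- **`(ij)² = -de`**: the third standard generator `φ ≫ ψ` of `(-d, -e)_ℚ ↪ End⁰(A)` satisfies
`(φ ≫ ψ) ≫ (φ ≫ ψ) = -((d e) • 𝟙 A)`. [cite: vanGeemenVerra2003QuaternionicPryms, §1.1] -/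
theorem comp_comp_self_of_anticomm (hφ : φ ≫ φ = -(d • 𝟙 A)) (hψ : ψ ≫ ψ = -(e • 𝟙 A))
    (h : φ ≫ ψ = -(ψ ≫ φ)) : (φ ≫ ψ) ≫ (φ ≫ ψ) = -((d * e) • 𝟙 A) := by
  rw [Category.assoc, comp_comp_right_of_sq' hψ h, Preadditive.comp_zsmul, hφ, smul_neg, natCast_zsmul,
    smul_smul, mul_comm]

/-- `φ` anticommutes with `φ ≫ ψ`: `i(ij) = -(ij)i`. [cite: vanGeemenVerra2003QuaternionicPryms, §1.1] -/
theorem anticomm_comp_of_anticomm (h : φ ≫ ψ = -(ψ ≫ φ)) : φ ≫ (φ ≫ ψ) = -((φ ≫ ψ) ≫ φ) := by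
  rw [Category.assoc, comp_eq_neg_comp_of_anticomm h, Preadditive.comp_neg, neg_neg]

/-- **The third quadratic subfield `ℚ(φψ) ≅ ℚ(√-de)` of `(-d, -e)_ℚ` is a Weil-type field of `A`**:
`IsWeilType A (φ ≫ ψ) n (d e)` (Lemma 4.5 for `K = ℚ(ij)`, with `j = i` as the anticommuting element).
[cite: vanGeemenVerra2003QuaternionicPryms, Lemma 4.5] -/
theorem isWeilType_comp_of_anticomm (hn : 0 < n) (hd : 0 < d) (he : 0 < e) (hA : A.dim = 2 * n)
    (hφ : φ ≫ φ = -(d • 𝟙 A)) (hψ : ψ ≫ ψ = -(e • 𝟙 A)) (h : φ ≫ ψ = -(ψ ≫ φ)) :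
    IsWeilType A (φ ≫ ψ) n (d * e) :=
  isWeilType_of_anticomm' hn hd (Nat.mul_pos hd he) hA hφ (comp_comp_self_of_anticomm hφ hψ h)
    (anticomm_comp_of_anticomm h)

/-- **`x² = -(a²d + b²e + c²de)` for the integral pure element `x = a·φ + b·ψ + c·φψ`** of the order
`ℤ⟨φ, ψ⟩ ⊂ (-d, -e)_ℚ ↪ End⁰(A)` (all cross anticommutators vanish).
[cite: vanGeemenVerra2003QuaternionicPryms, §1.1] -/
theorem pure_comp_pure_eq (hφ : φ ≫ φ = -(d • 𝟙 A)) (hψ : ψ ≫ ψ = -(e • 𝟙 A))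
    (h : φ ≫ ψ = -(ψ ≫ φ)) (a b c : ℤ) {m : ℕ}
    (hm : (m : ℤ) = a ^ 2 * d + b ^ 2 * e + c ^ 2 * (d * e)) :
    (a • φ + b • ψ + c • (φ ≫ ψ)) ≫ (a • φ + b • ψ + c • (φ ≫ ψ)) = -(m • 𝟙 A) := by
  have hφ' : φ ≫ φ = -((d : ℤ) • 𝟙 A) := by rw [natCast_zsmul]; exact hφ
  have hψ' : ψ ≫ ψ = -((e : ℤ) • 𝟙 A) := by rw [natCast_zsmul]; exact hψ
  have h3 := comp_eq_neg_comp_of_anticomm h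
  have h4 := comp_comp_right_of_sq (ψ := ψ) hφ
  have h5 := comp_comp_right_of_sq' hψ h
  rw [← natCast_zsmul, hm]
  simp only [Preadditive.add_comp, Preadditive.comp_add, Preadditive.zsmul_comp, Preadditive.comp_zsmul,
    Category.assoc, hφ', hψ', h3, h4, h5, Preadditive.comp_neg, smul_neg, neg_neg, Category.comp_id,
    smul_smul]
  module

/-- **`x = a·φ + b·ψ + c·φψ` anticommutes with `y = be·φ - ad·ψ`** (a pure element orthogonal to `x`).
[cite: vanGeemenVerra2003QuaternionicPryms, §1.1 and proof of Lemma 4.5] -/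
theorem pure_anticomm (hφ : φ ≫ φ = -(d • 𝟙 A)) (hψ : ψ ≫ ψ = -(e • 𝟙 A))
    (h : φ ≫ ψ = -(ψ ≫ φ)) (a b c : ℤ) :
    (a • φ + b • ψ + c • (φ ≫ ψ)) ≫ ((b * e : ℤ) • φ + (-(a * d) : ℤ) • ψ + (0 : ℤ) • (φ ≫ ψ)) =
      -(((b * e : ℤ) • φ + (-(a * d) : ℤ) • ψ + (0 : ℤ) • (φ ≫ ψ)) ≫ (a • φ + b • ψ + c • (φ ≫ ψ))) := by
  have hφ' : φ ≫ φ = -((d : ℤ) • 𝟙 A) := by rw [natCast_zsmul]; exact hφ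
  have hψ' : ψ ≫ ψ = -((e : ℤ) • 𝟙 A) := by rw [natCast_zsmul]; exact hψ
  have h3 := comp_eq_neg_comp_of_anticomm h
  have h4 := comp_comp_right_of_sq (ψ := ψ) hφ
  have h5 := comp_comp_right_of_sq' hψ h
  simp only [Preadditive.add_comp, Preadditive.comp_add, Preadditive.zsmul_comp, Preadditive.comp_zsmul,
    Category.assoc, hφ', hψ', h3, h4, h5, Preadditive.comp_neg, smul_neg, neg_neg, Category.comp_id,
    smul_smul, zero_smul, add_zero, neg_add_rev]
  module

/-- **Lemma 4.5 for EVERY quadratic subfield of `(-d, -e)_ℚ`**: for all integers `(a, b, c) ≠ (0, 0, 0)`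
the pure element `x = a·φ + b·ψ + c·φψ` (`x² = -m`, `m = a²d + b²e + c²de ≥ 1`) makes `(A, ℚ(x))`,
`ℚ(x) ≅ ℚ(√-m)`, an abelian variety of Weil type `(n, m)` — "Let `K ⊂ F` be a quadratic extension of `ℚ`.
Then `A` is of Weil type for `K`" (every quadratic subfield of `F` is `ℚ(x)` for a pure `x`, unique up to
`ℚ^×`). The anticommuting partner is `be·φ - ad·ψ` if `(a, b) ≠ (0, 0)` and `φ` if `x = c·φψ`.
[cite: vanGeemenVerra2003QuaternionicPryms, Lemma 4.5] -/
theorem isWeilType_pure_of_anticomm (hn : 0 < n) (hd : 0 < d) (he : 0 < e) (hA : A.dim = 2 * n)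
    (hφ : φ ≫ φ = -(d • 𝟙 A)) (hψ : ψ ≫ ψ = -(e • 𝟙 A)) (h : φ ≫ ψ = -(ψ ≫ φ))
    (a b c : ℤ) (habc : a ≠ 0 ∨ b ≠ 0 ∨ c ≠ 0) {m : ℕ}
    (hm : (m : ℤ) = a ^ 2 * d + b ^ 2 * e + c ^ 2 * (d * e)) :
    IsWeilType A (a • φ + b • ψ + c • (φ ≫ ψ)) n m := by
  have hd' : (0 : ℤ) < d := by exact_mod_cast hd
  have he' : (0 : ℤ) < e := by exact_mod_cast he
  have hx2 := pure_comp_pure_eq hφ hψ h a b c hm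
  by_cases hab : a = 0 ∧ b = 0
  · -- `x = c • φψ`, `c ≠ 0`: the partner is `φ`
    obtain ⟨rfl, rfl⟩ := hab
    have hc : c ≠ 0 := by
      rcases habc with h0 | h0 | h0
      · exact (h0 rfl).elim
      · exact (h0 rfl).elim
      · exact h0
    have hm0 : 0 < m := by
      have : (0 : ℤ) < m := by rw [hm]; positivity
      exact_mod_cast this
    refine isWeilType_of_anticomm_of_injective hn hm0 hA hx2 ?_
      (complexBetti_map_one_injective_of_comp_self hφ hd)
    -- `x ≫ φ = -(φ ≫ x)` for `x = c • φψ`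
    rw [zero_smul, zero_smul, zero_add, zero_add, Preadditive.zsmul_comp, Preadditive.comp_zsmul,
      anticomm_comp_of_anticomm h, smul_neg, neg_neg]
  · -- `(a, b) ≠ (0, 0)`: the partner is `y = be·φ - ad·ψ`, `y² = -(b²e²d + a²d²e)`
    have hab' : a ≠ 0 ∨ b ≠ 0 := not_and_or.mp hab
    have hm0 : 0 < m := by
      have : (0 : ℤ) < m := by
        rw [hm]
        rcases hab' with h0 | h0
        · positivity
        · positivity
      exact_mod_cast this
    -- the partner's square: `m' = (be)²d + (ad)²e`
    have hnonneg : (0 : ℤ) ≤ (b * e) ^ 2 * d + (a * d) ^ 2 * e := by positivity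
    obtain ⟨m', hm'ℤ⟩ := Int.eq_ofNat_of_zero_le hnonneg
    have hm' : (m' : ℤ) = (b * e) ^ 2 * d + (-(a * d)) ^ 2 * e + 0 ^ 2 * (d * e) := by
      rw [← hm'ℤ]; ring
    have hm'0 : 0 < m' := by
      have : (0 : ℤ) < m' := by
        rw [← hm'ℤ]
        rcases hab' with h0 | h0
        · positivity
        · positivity
      exact_mod_cast this
    have hy2 := pure_comp_pure_eq hφ hψ h (b * e) (-(a * d)) 0 hm'
    exact isWeilType_of_anticomm_of_injective hn hm0 hA hx2 (pure_anticomm hφ hψ h a b c)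
      (complexBetti_map_one_injective_of_comp_self hy2 hm'0)

end EverySubfield

end Literature.AlgebraicGeometry.HodgeTheory

end
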